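import Literature.Analysis.FluidPDE.StretchedLayerNS
import HarnessLib

/-!
# Tools for the stub `stub_braidExit` (line `braid-closed-large-circulation-gluing`, crux
# stmt-AnomalousDissipation-3009 `MarginalStabilityChain.StretchedVortexRows`), part A: the radial layer

The stub asks for an explicit `C²` supersolution `φ ≥ 0` of the passive row operator
`𝒜φ = νΔφ + U₀·∇φ ≤ −1` on the plane minus the core discs of radius `r` about `Lℤ × {0}`, where
`U₀ = (u₀, v₀ − y)`, `u₀ = sinh b/(2D)`, `v₀ = −sin a/(2D)`, `a = 2πx/L`, `b = 2πy/L`,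
`D = cosh b − cos a` (point-vortex row of circulation `−L` plus the plane strain `(0, −y)`), with the
exit-time size `φ ≤ C(1 + log(L²/ν))(1 + log(1 + |y|/L))`. This file is the self-contained RADIAL /
FAR-FIELD LAYER of that construction, in the tree's slice-derivative vocabulary
`StretchedLayer.dX/dY/lap` (`Literature.Analysis.FluidPDE.StretchedLayerNS`).

## Contents (namespace `…MarginalStabilityChainStretchedVortexRows.BraidExit`)

* `rowD`, `rowE`, `radialLayer L G = G ∘ log ∘ D`; `hasDerivAt_rowD_fst/snd`.
* Slice derivatives of the radial layer at a point with `D > 0`, `log D ∈ U` (`U` open, `G` with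
  derivatives `G'`, `G''` on `U` in `HasDerivAt` form; `eventually_rowD_fst/snd`,
  `hasDerivAt_radialLayer_fst/snd`): `dX_/dY_/dXX_/dYY_radialLayer`, and the two
  structural identities
  `lap_radialLayer : Δ G(log D) = (2π/L)² (E/D) G''(log D)` (`log D` is harmonic off the lattice,
  `sin²a + sinh²b = D·E`), and
  `rowOperator_radialLayer : νΔΦ + U₀·∇Φ = ν(2π/L)²(E/D)G''(log D) − G'(log D)·(b sinh b)/D` — the row
  part of the drift is tangent to `{D = const}`, only the compression transports `log D`, and
  `U₀·∇D = −b sinh b ≤ 0` EXACTLY (no averaging, no smallness of `L`).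
* `rowOperator_radialLayer_le`: for `G' ≥ 0`, `G'' ≤ 0` at `log D`, `ν ≥ 0`, `L > 0`:
  `𝒜Φ ≤ −G'(log D) · b sinh b/(cosh b + 1) = −G'(log D)· b tanh(b/2) ≤ 0`; with part B's
  `one_le_mul_sinh_div` this is `≤ −G'(log D)` in the far field `|y| ≥ L/2` (every `L`, `x`).
* `rowD_nonneg`, `rowD_eq_zero_iff` (zero set = lattice), `rowD_pos_of_forall` (positive off the
  core discs), `rowD_le`, `rowE_nonneg`, `mul_sinh_nonneg`, `radialLayer_periodic`, `contDiff_rowD`,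
  `contDiffOn_radialLayer`, `continuousOn_radialLayer` (regularity on `{D > 0, log D ∈ U}`).

## Role in the stub (design note)

With `s₀ = log(1 − cos(2πr/L))` (the minimum of `log D` on the closed outer domain, part B
`cosh_sub_cos_ge_of_forall`), `Λ = 1 + log(L²/ν)` and `G(s) = AΛ log(1 + (s − s₀)/Λ)` on
`U = (s₀ − Λ, ∞)` one gets `Φ ≥ 0` on the closed outer domain, `G' ∈ [A/2, A]` on the cells
(`s − s₀ ≤ Λ` for `|b| ≤ π`), `G'' < 0`, `Φ ≤ C·A·Λ(1 + log(1 + |y|/L))`, and `𝒜Φ ≤ −1` wherever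
`b tanh(b/2) ≥ 2/A·(1 + (s − s₀)/Λ)`, in particular on `|y| ≥ L/2` for `A ≥ 8`: the far-field and
the radial core part (`b sinh b/D ≈ 2 sin²θ` near a core) of the exit-time bound. The angular
corrector, the domain lemmas and the account of what is still missing (the saddle layer) are in part B
(`…StubBraidExitDomain`). Pure tool file: no statement of the line is restated here. -/

-- `Summit.<Summit>.<Problem>` is the mandated summit-side namespace (CONVENTIONS §2): duplicate deliberate.
set_option linter.dupNamespace false

noncomputable section

open scoped Topology
open Filter Set

namespace Summit.AnomalousDissipation.AnomalousDissipation.Theorems.MarginalStabilityChainStretchedVortexRows.BraidExit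

open Literature.Analysis.FluidPDE Literature.Analysis.FluidPDE.StretchedLayer

/-- `D(x, y) = cosh(2πy/L) − cos(2πx/L) = 2|sin(πz/L)|²`, `z = x + iy`: twice the denominator of the
stub's drift; `(L/4π) log D` is the stream function of the point-vortex row of circulation `−L` at
`Lℤ × {0}` (Lamb, *Hydrodynamics* §156; Saffman, *Vortex Dynamics* §7.2). `D ≥ 0`, `= 0` exactly on the
lattice. [folklore] -/
def rowD (L x y : ℝ) : ℝ := Real.cosh (2 * Real.pi * y / L) - Real.cos (2 * Real.pi * x / L)

/-- `E(x, y) = cosh(2πy/L) + cos(2πx/L) = (L/2π)² ΔD ≥ 0`, vanishing exactly at the saddles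
`((n+½)L, 0)`; `|∇D|² = (2π/L)² D E`. [folklore] -/
def rowE (L x y : ℝ) : ℝ := Real.cosh (2 * Real.pi * y / L) + Real.cos (2 * Real.pi * x / L)

/-- The **radial layer** `Φ_G(x, y) = G(log D(x, y))`: a function of the row stream function alone
(profile `G : ℝ → ℝ`). [folklore] -/
def radialLayer (L : ℝ) (G : ℝ → ℝ) (x y : ℝ) : ℝ := G (Real.log (rowD L x y))

/-- `∂ₓ D = (2π/L) sin a`. [folklore] -/
theorem hasDerivAt_rowD_fst (L x y : ℝ) :
    HasDerivAt (fun s => rowD L s y) (2 * Real.pi / L * Real.sin (2 * Real.pi * x / L)) x := by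
  unfold rowD
  have h1 : HasDerivAt (fun s : ℝ => 2 * Real.pi * s / L) (2 * Real.pi / L) x := by
    simpa using ((hasDerivAt_id x).const_mul (2 * Real.pi)).div_const L
  exact ((hasDerivAt_const x (Real.cosh (2 * Real.pi * y / L))).sub h1.cos).congr_deriv (by ring)

/-- `∂_y D = (2π/L) sinh b`. [folklore] -/
theorem hasDerivAt_rowD_snd (L x y : ℝ) :
    HasDerivAt (fun s => rowD L x s) (2 * Real.pi / L * Real.sinh (2 * Real.pi * y / L)) y := by
  unfold rowD
  have h1 : HasDerivAt (fun s : ℝ => 2 * Real.pi * s / L) (2 * Real.pi / L) y := by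
    simpa using ((hasDerivAt_id y).const_mul (2 * Real.pi)).div_const L
  exact (h1.cosh.sub (hasDerivAt_const y (Real.cos (2 * Real.pi * x / L)))).congr_deriv (by ring)

variable {L : ℝ}

/-- Near a point where `D > 0` and `log D ∈ U` (`U` open) the same holds along the `x`-slice. [folklore] -/
theorem eventually_rowD_fst {U : Set ℝ} (hU : IsOpen U) {x y : ℝ} (hD : 0 < rowD L x y)
    (hU' : Real.log (rowD L x y) ∈ U) :
    ∀ᶠ s in 𝓝 x, 0 < rowD L s y ∧ Real.log (rowD L s y) ∈ U := by
  have hc : ContinuousAt (fun s => rowD L s y) x := (hasDerivAt_rowD_fst L x y).continuousAt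
  have hlog : ContinuousAt (fun s => Real.log (rowD L s y)) x := hc.log hD.ne'
  exact (hc.eventually (Ioi_mem_nhds hD)).and (hlog.eventually (hU.mem_nhds hU'))

/-- Near a point where `D > 0` and `log D ∈ U` (`U` open) the same holds along the `y`-slice. [folklore] -/
theorem eventually_rowD_snd {U : Set ℝ} (hU : IsOpen U) {x y : ℝ} (hD : 0 < rowD L x y)
    (hU' : Real.log (rowD L x y) ∈ U) :
    ∀ᶠ s in 𝓝 y, 0 < rowD L x s ∧ Real.log (rowD L x s) ∈ U := by
  have hc : ContinuousAt (fun s => rowD L x s) y := (hasDerivAt_rowD_snd L x y).continuousAt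
  have hlog : ContinuousAt (fun s => Real.log (rowD L x s)) y := hc.log hD.ne'
  exact (hc.eventually (Ioi_mem_nhds hD)).and (hlog.eventually (hU.mem_nhds hU'))

/-- `∂ₓ G(log D) = G'(log D) · Dₓ / D` (HasDerivAt form). [folklore] -/
theorem hasDerivAt_radialLayer_fst {U : Set ℝ} {G G' : ℝ → ℝ}
    (hG : ∀ s ∈ U, HasDerivAt G (G' s) s) {x y : ℝ} (hD : 0 < rowD L x y)
    (hU' : Real.log (rowD L x y) ∈ U) :
    HasDerivAt (fun s => radialLayer L G s y)
      (G' (Real.log (rowD L x y)) *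
        (2 * Real.pi / L * Real.sin (2 * Real.pi * x / L) / rowD L x y)) x :=
  (hG _ hU').comp x ((hasDerivAt_rowD_fst L x y).log hD.ne')

/-- `∂_y G(log D) = G'(log D) · D_y / D` (HasDerivAt form). [folklore] -/
theorem hasDerivAt_radialLayer_snd {U : Set ℝ} {G G' : ℝ → ℝ}
    (hG : ∀ s ∈ U, HasDerivAt G (G' s) s) {x y : ℝ} (hD : 0 < rowD L x y)
    (hU' : Real.log (rowD L x y) ∈ U) :
    HasDerivAt (fun s => radialLayer L G x s)
      (G' (Real.log (rowD L x y)) *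
        (2 * Real.pi / L * Real.sinh (2 * Real.pi * y / L) / rowD L x y)) y :=
  (hG _ hU').comp y ((hasDerivAt_rowD_snd L x y).log hD.ne')

/-- `∂ₓ` of the radial layer. [folklore] -/
theorem dX_radialLayer {U : Set ℝ} {G G' : ℝ → ℝ}
    (hG : ∀ s ∈ U, HasDerivAt G (G' s) s) {x y : ℝ} (hD : 0 < rowD L x y)
    (hU' : Real.log (rowD L x y) ∈ U) :
    dX (radialLayer L G) x y =
      G' (Real.log (rowD L x y)) *
        (2 * Real.pi / L * Real.sin (2 * Real.pi * x / L) / rowD L x y) :=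
  (hasDerivAt_radialLayer_fst hG hD hU').deriv

/-- `∂_y` of the radial layer. [folklore] -/
theorem dY_radialLayer {U : Set ℝ} {G G' : ℝ → ℝ}
    (hG : ∀ s ∈ U, HasDerivAt G (G' s) s) {x y : ℝ} (hD : 0 < rowD L x y)
    (hU' : Real.log (rowD L x y) ∈ U) :
    dY (radialLayer L G) x y =
      G' (Real.log (rowD L x y)) *
        (2 * Real.pi / L * Real.sinh (2 * Real.pi * y / L) / rowD L x y) :=
  (hasDerivAt_radialLayer_snd hG hD hU').deriv

/-- `∂ₓ∂ₓ` of the radial layer. [folklore] -/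
theorem dXX_radialLayer {U : Set ℝ} (hU : IsOpen U) {G G' G'' : ℝ → ℝ}
    (hG : ∀ s ∈ U, HasDerivAt G (G' s) s) (hG' : ∀ s ∈ U, HasDerivAt G' (G'' s) s)
    {x y : ℝ} (hD : 0 < rowD L x y) (hU' : Real.log (rowD L x y) ∈ U) :
    dX (dX (radialLayer L G)) x y =
      G'' (Real.log (rowD L x y)) *
          (2 * Real.pi / L * Real.sin (2 * Real.pi * x / L) / rowD L x y) ^ 2 +
        G' (Real.log (rowD L x y)) *
          (((2 * Real.pi / L) ^ 2 * Real.cos (2 * Real.pi * x / L) * rowD L x y -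
              (2 * Real.pi / L * Real.sin (2 * Real.pi * x / L)) ^ 2) / rowD L x y ^ 2) := by
  -- near `x` the first derivative is given by the closed formula
  have hev : (fun s => dX (radialLayer L G) s y) =ᶠ[𝓝 x] fun s =>
      G' (Real.log (rowD L s y)) * (2 * Real.pi / L * Real.sin (2 * Real.pi * s / L) / rowD L s y) := by
    filter_upwards [eventually_rowD_fst hU hD hU'] with s hs
    exact dX_radialLayer hG hs.1 hs.2
  show deriv (fun s => dX (radialLayer L G) s y) x = _
  rw [hev.deriv_eq]
  -- differentiate the closed formula
  have hℓ : HasDerivAt (fun s => Real.log (rowD L s y))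
      (2 * Real.pi / L * Real.sin (2 * Real.pi * x / L) / rowD L x y) x :=
    (hasDerivAt_rowD_fst L x y).log hD.ne'
  have h1 : HasDerivAt (fun s => G' (Real.log (rowD L s y)))
      (G'' (Real.log (rowD L x y)) * (2 * Real.pi / L * Real.sin (2 * Real.pi * x / L) / rowD L x y))
      x := (hG' _ hU').comp x hℓ
  have hlin : HasDerivAt (fun s : ℝ => 2 * Real.pi * s / L) (2 * Real.pi / L) x := by
    simpa using ((hasDerivAt_id x).const_mul (2 * Real.pi)).div_const L
  have h2 : HasDerivAt (fun s => 2 * Real.pi / L * Real.sin (2 * Real.pi * s / L))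
      (2 * Real.pi / L * (Real.cos (2 * Real.pi * x / L) * (2 * Real.pi / L))) x :=
    hlin.sin.const_mul _
  have h3 : HasDerivAt
      (fun s => 2 * Real.pi / L * Real.sin (2 * Real.pi * s / L) / rowD L s y) _ x :=
    h2.div (hasDerivAt_rowD_fst L x y) hD.ne'
  have h4 : HasDerivAt (fun s => G' (Real.log (rowD L s y)) *
      (2 * Real.pi / L * Real.sin (2 * Real.pi * s / L) / rowD L s y)) _ x := h1.mul h3
  rw [h4.deriv]
  field_simp

/-- `∂_y∂_y` of the radial layer. [folklore] -/
theorem dYY_radialLayer {U : Set ℝ} (hU : IsOpen U) {G G' G'' : ℝ → ℝ}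
    (hG : ∀ s ∈ U, HasDerivAt G (G' s) s) (hG' : ∀ s ∈ U, HasDerivAt G' (G'' s) s)
    {x y : ℝ} (hD : 0 < rowD L x y) (hU' : Real.log (rowD L x y) ∈ U) :
    dY (dY (radialLayer L G)) x y =
      G'' (Real.log (rowD L x y)) *
          (2 * Real.pi / L * Real.sinh (2 * Real.pi * y / L) / rowD L x y) ^ 2 +
        G' (Real.log (rowD L x y)) *
          (((2 * Real.pi / L) ^ 2 * Real.cosh (2 * Real.pi * y / L) * rowD L x y -
              (2 * Real.pi / L * Real.sinh (2 * Real.pi * y / L)) ^ 2) / rowD L x y ^ 2) := by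
  have hev : (fun s => dY (radialLayer L G) x s) =ᶠ[𝓝 y] fun s =>
      G' (Real.log (rowD L x s)) *
        (2 * Real.pi / L * Real.sinh (2 * Real.pi * s / L) / rowD L x s) := by
    filter_upwards [eventually_rowD_snd hU hD hU'] with s hs
    exact dY_radialLayer hG hs.1 hs.2
  show deriv (fun s => dY (radialLayer L G) x s) y = _
  rw [hev.deriv_eq]
  have hℓ : HasDerivAt (fun s => Real.log (rowD L x s))
      (2 * Real.pi / L * Real.sinh (2 * Real.pi * y / L) / rowD L x y) y :=
    (hasDerivAt_rowD_snd L x y).log hD.ne'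
  have h1 : HasDerivAt (fun s => G' (Real.log (rowD L x s)))
      (G'' (Real.log (rowD L x y)) *
        (2 * Real.pi / L * Real.sinh (2 * Real.pi * y / L) / rowD L x y)) y :=
    (hG' _ hU').comp y hℓ
  have hlin : HasDerivAt (fun s : ℝ => 2 * Real.pi * s / L) (2 * Real.pi / L) y := by
    simpa using ((hasDerivAt_id y).const_mul (2 * Real.pi)).div_const L
  have h2 : HasDerivAt (fun s => 2 * Real.pi / L * Real.sinh (2 * Real.pi * s / L))
      (2 * Real.pi / L * (Real.cosh (2 * Real.pi * y / L) * (2 * Real.pi / L))) y :=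
    hlin.sinh.const_mul _
  have h3 : HasDerivAt
      (fun s => 2 * Real.pi / L * Real.sinh (2 * Real.pi * s / L) / rowD L x s) _ y :=
    h2.div (hasDerivAt_rowD_snd L x y) hD.ne'
  have h4 : HasDerivAt (fun s => G' (Real.log (rowD L x s)) *
      (2 * Real.pi / L * Real.sinh (2 * Real.pi * s / L) / rowD L x s)) _ y := h1.mul h3
  rw [h4.deriv]
  field_simp

/-- The key algebraic identity `sin² a + sinh² b = D · E`. [folklore] -/
theorem sin_sq_add_sinh_sq (L x y : ℝ) :
    Real.sin (2 * Real.pi * x / L) ^ 2 + Real.sinh (2 * Real.pi * y / L) ^ 2 =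
      rowD L x y * rowE L x y := by
  have h1 := Real.sin_sq_add_cos_sq (2 * Real.pi * x / L)
  have h2 := Real.cosh_sq_sub_sinh_sq (2 * Real.pi * y / L)
  unfold rowD rowE
  nlinarith [h1, h2]

/-- **Laplacian of the radial layer**: `Δ G(log D) = (2π/L)² (E/D) G''(log D)` — the `G'`-terms cancel
because `log D` is harmonic off the lattice. [folklore] -/
theorem lap_radialLayer {U : Set ℝ} (hU : IsOpen U) {G G' G'' : ℝ → ℝ}
    (hG : ∀ s ∈ U, HasDerivAt G (G' s) s) (hG' : ∀ s ∈ U, HasDerivAt G' (G'' s) s)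
    {x y : ℝ} (hD : 0 < rowD L x y) (hU' : Real.log (rowD L x y) ∈ U) :
    lap (radialLayer L G) x y =
      (2 * Real.pi / L) ^ 2 * (rowE L x y / rowD L x y) * G'' (Real.log (rowD L x y)) := by
  rw [lap_apply, dXX_radialLayer hU hG hG' hD hU', dYY_radialLayer hU hG hG' hD hU']
  have hid := sin_sq_add_sinh_sq L x y
  have hE : rowE L x y = Real.cosh (2 * Real.pi * y / L) + Real.cos (2 * Real.pi * x / L) := rfl
  field_simp
  rw [hE] at hid ⊢
  linear_combination (G'' (Real.log (rowD L x y)) - G' (Real.log (rowD L x y))) * hid / L ^ 2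

/-- **The passive row operator on the radial layer** (exact identity): with the stub's drift
`U₀ = (sinh b /(2D), −sin a/(2D) − y)`, `a = 2πx/L`, `b = 2πy/L`,
`ν ΔΦ + U₀·∇Φ = ν (2π/L)² (E/D) G''(log D) − G'(log D) · (b sinh b)/D` — the row part of the drift is
tangent to the level sets of `D`, only the compression `−y∂_y` transports `log D`. [folklore] -/
theorem rowOperator_radialLayer {U : Set ℝ} (hU : IsOpen U) {G G' G'' : ℝ → ℝ}
    (hG : ∀ s ∈ U, HasDerivAt G (G' s) s) (hG' : ∀ s ∈ U, HasDerivAt G' (G'' s) s)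
    (ν : ℝ) {x y : ℝ} (hD : 0 < rowD L x y) (hU' : Real.log (rowD L x y) ∈ U) :
    ν * lap (radialLayer L G) x y +
        Real.sinh (2 * Real.pi * y / L) /
            (2 * (Real.cosh (2 * Real.pi * y / L) - Real.cos (2 * Real.pi * x / L))) *
          dX (radialLayer L G) x y +
        (-(Real.sin (2 * Real.pi * x / L) /
            (2 * (Real.cosh (2 * Real.pi * y / L) - Real.cos (2 * Real.pi * x / L)))) - y) *
          dY (radialLayer L G) x y =
      ν * (2 * Real.pi / L) ^ 2 * (rowE L x y / rowD L x y) * G'' (Real.log (rowD L x y)) -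
        G' (Real.log (rowD L x y)) *
          (2 * Real.pi * y / L * Real.sinh (2 * Real.pi * y / L) / rowD L x y) := by
  rw [lap_radialLayer hU hG hG' hD hU', dX_radialLayer hG hD hU', dY_radialLayer hG hD hU']
  have hD' : Real.cosh (2 * Real.pi * y / L) - Real.cos (2 * Real.pi * x / L) = rowD L x y := rfl
  rw [hD']
  field_simp
  ring

/-- `y ↦ y · sinh(2πy/L)` is nonnegative for `L > 0` (the compression always decreases `D`). [folklore] -/
theorem mul_sinh_nonneg (hL : 0 < L) (y : ℝ) : 0 ≤ y * Real.sinh (2 * Real.pi * y / L) := by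
  rcases le_total 0 y with hy | hy
  · exact mul_nonneg hy (Real.sinh_nonneg_iff.2 (by positivity))
  · have : Real.sinh (2 * Real.pi * y / L) ≤ 0 := by
      rw [← neg_nonneg, ← Real.sinh_neg]
      exact Real.sinh_nonneg_iff.2 (by
        have : 2 * Real.pi * (-y) / L = -(2 * Real.pi * y / L) := by ring
        rw [← this]; exact div_nonneg (mul_nonneg (by positivity) (neg_nonneg.2 hy)) hL.le)
    exact mul_nonneg_of_nonpos_of_nonpos hy this

/-- `E = cosh b + cos a ≥ 0`. [folklore] -/
theorem rowE_nonneg (L x y : ℝ) : 0 ≤ rowE L x y := by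
  unfold rowE
  linarith [Real.one_le_cosh (2 * Real.pi * y / L), Real.neg_one_le_cos (2 * Real.pi * x / L)]

/-- `D ≤ cosh b + 1`. [folklore] -/
theorem rowD_le (L x y : ℝ) : rowD L x y ≤ Real.cosh (2 * Real.pi * y / L) + 1 := by
  unfold rowD; linarith [Real.neg_one_le_cos (2 * Real.pi * x / L)]

/-- **The radial layer is a supersolution wherever `G` is increasing and concave**: for `ν ≥ 0`,
`L > 0`, off the lattice, `ν ΔΦ + U₀·∇Φ ≤ −G'(log D) · b sinh b/(cosh b + 1) = −G'(log D) · b tanh(b/2)`,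
`b = 2πy/L`; the right side is `≤ 0`, and `≤ −G'(log D)` in the far field `|y| ≥ L/2` (part B,
`one_le_mul_sinh_div`). [folklore] -/
theorem rowOperator_radialLayer_le {U : Set ℝ} (hU : IsOpen U) {G G' G'' : ℝ → ℝ}
    (hG : ∀ s ∈ U, HasDerivAt G (G' s) s) (hG' : ∀ s ∈ U, HasDerivAt G' (G'' s) s)
    {ν : ℝ} (hν : 0 ≤ ν) (hL : 0 < L) {x y : ℝ} (hD : 0 < rowD L x y)
    (hU' : Real.log (rowD L x y) ∈ U) (hmono : 0 ≤ G' (Real.log (rowD L x y)))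
    (hconc : G'' (Real.log (rowD L x y)) ≤ 0) :
    ν * lap (radialLayer L G) x y +
        Real.sinh (2 * Real.pi * y / L) /
            (2 * (Real.cosh (2 * Real.pi * y / L) - Real.cos (2 * Real.pi * x / L))) *
          dX (radialLayer L G) x y +
        (-(Real.sin (2 * Real.pi * x / L) /
            (2 * (Real.cosh (2 * Real.pi * y / L) - Real.cos (2 * Real.pi * x / L)))) - y) *
          dY (radialLayer L G) x y ≤
      -(G' (Real.log (rowD L x y)) *
        (2 * Real.pi * y / L * Real.sinh (2 * Real.pi * y / L) /
          (Real.cosh (2 * Real.pi * y / L) + 1))) := by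
  rw [rowOperator_radialLayer hU hG hG' ν hD hU']
  have hE := rowE_nonneg L x y
  have h1 : ν * (2 * Real.pi / L) ^ 2 * (rowE L x y / rowD L x y) * G'' (Real.log (rowD L x y)) ≤ 0 :=
    mul_nonpos_of_nonneg_of_nonpos (by positivity) hconc
  have hβ : 0 ≤ 2 * Real.pi * y / L * Real.sinh (2 * Real.pi * y / L) := by
    have := mul_sinh_nonneg hL y
    have : 2 * Real.pi * y / L * Real.sinh (2 * Real.pi * y / L) =
        2 * Real.pi / L * (y * Real.sinh (2 * Real.pi * y / L)) := by ring
    rw [this]; positivity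
  have h2 : 2 * Real.pi * y / L * Real.sinh (2 * Real.pi * y / L) /
        (Real.cosh (2 * Real.pi * y / L) + 1) ≤
      2 * Real.pi * y / L * Real.sinh (2 * Real.pi * y / L) / rowD L x y :=
    div_le_div_of_nonneg_left hβ hD (rowD_le L x y)
  nlinarith [mul_le_mul_of_nonneg_left h2 hmono]

/-- `D ≥ 0` everywhere. [folklore] -/
theorem rowD_nonneg (L x y : ℝ) : 0 ≤ rowD L x y := by
  unfold rowD; linarith [Real.one_le_cosh (2 * Real.pi * y / L), Real.cos_le_one (2 * Real.pi * x / L)]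

/-- `D` vanishes only on the lattice `Lℤ × {0}` (`L ≠ 0`). [folklore] -/
theorem rowD_eq_zero_iff (hL : L ≠ 0) (x y : ℝ) :
    rowD L x y = 0 ↔ y = 0 ∧ ∃ n : ℤ, x = n * L := by
  constructor
  · intro h
    have h1 := Real.one_le_cosh (2 * Real.pi * y / L)
    have h2 := Real.cos_le_one (2 * Real.pi * x / L)
    have hcosh : Real.cosh (2 * Real.pi * y / L) = 1 := by unfold rowD at h; linarith
    have hcos : Real.cos (2 * Real.pi * x / L) = 1 := by unfold rowD at h; linarith
    refine ⟨?_, ?_⟩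
    · by_contra hy
      have : (1 : ℝ) < Real.cosh (2 * Real.pi * y / L) :=
        Real.one_lt_cosh.2 (by positivity)
      linarith
    · obtain ⟨n, hn⟩ := (Real.cos_eq_one_iff _).1 hcos
      refine ⟨n, ?_⟩
      field_simp at hn
      nlinarith [Real.pi_pos]
  · rintro ⟨rfl, n, rfl⟩
    unfold rowD
    have : 2 * Real.pi * (n * L) / L = (n : ℝ) * (2 * Real.pi) := by field_simp
    rw [this, (Real.cos_eq_one_iff _).2 ⟨n, rfl⟩]
    simp

/-- `D > 0` off the open core discs of any radius `r > 0` about the lattice (in particular on the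
closed outer domain of the stub, cf. part B `closure_outer_subset`): such a point is not a lattice
point. [folklore] -/
theorem rowD_pos_of_forall (hL : L ≠ 0) {r x y : ℝ} (hr : 0 < r)
    (h : ∀ n : ℤ, r ^ 2 ≤ (x - n * L) ^ 2 + y ^ 2) : 0 < rowD L x y := by
  rcases (rowD_nonneg L x y).lt_or_eq with hpos | hzero
  · exact hpos
  · exfalso
    obtain ⟨hy, n, hx⟩ := (rowD_eq_zero_iff hL x y).1 hzero.symm
    have := h n
    rw [hy, hx] at this
    nlinarith

/-- The radial layer is `L`-periodic in `x`. [folklore] -/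
theorem radialLayer_periodic (hL : L ≠ 0) (G : ℝ → ℝ) (x y : ℝ) :
    radialLayer L G (x + L) y = radialLayer L G x y := by
  unfold radialLayer rowD
  have : 2 * Real.pi * (x + L) / L = 2 * Real.pi * x / L + 2 * Real.pi := by field_simp
  rw [this, Real.cos_add_two_pi]

/-- `D` is smooth on the plane (jointly). [folklore] -/
theorem contDiff_rowD (L : ℝ) {n : WithTop ℕ∞} : ContDiff ℝ n (fun q : ℝ × ℝ => rowD L q.1 q.2) := by
  unfold rowD
  fun_prop

/-- **Regularity of the radial layer**: if `G` is `Cⁿ` on the open set `U`, then `(x,y) ↦ G(log D)` is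
`Cⁿ` jointly on `{D > 0, log D ∈ U}`. [folklore] -/
theorem contDiffOn_radialLayer {U : Set ℝ} {G : ℝ → ℝ} {n : WithTop ℕ∞} (hG : ContDiffOn ℝ n G U) :
    ContDiffOn ℝ n (fun q : ℝ × ℝ => radialLayer L G q.1 q.2)
      {q : ℝ × ℝ | 0 < rowD L q.1 q.2 ∧ Real.log (rowD L q.1 q.2) ∈ U} := by
  have h1 : ContDiffOn ℝ n (fun q : ℝ × ℝ => Real.log (rowD L q.1 q.2))
      {q : ℝ × ℝ | 0 < rowD L q.1 q.2 ∧ Real.log (rowD L q.1 q.2) ∈ U} :=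
    ((contDiff_rowD L).contDiffOn.log fun q hq => hq.1.ne')
  exact hG.comp h1 fun q hq => hq.2

/-- Continuity of the radial layer on `{D > 0, log D ∈ U}` from continuity of `G` on `U`. [folklore] -/
theorem continuousOn_radialLayer {U : Set ℝ} {G : ℝ → ℝ} (hG : ContinuousOn G U) :
    ContinuousOn (fun q : ℝ × ℝ => radialLayer L G q.1 q.2)
      {q : ℝ × ℝ | 0 < rowD L q.1 q.2 ∧ Real.log (rowD L q.1 q.2) ∈ U} := by
  have h1 : ContinuousOn (fun q : ℝ × ℝ => Real.log (rowD L q.1 q.2))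
      {q : ℝ × ℝ | 0 < rowD L q.1 q.2 ∧ Real.log (rowD L q.1 q.2) ∈ U} :=
    ((contDiff_rowD L (n := 0)).continuous.continuousOn.log fun q hq => hq.1.ne')
  exact hG.comp h1 fun q hq => hq.2

/-- **Registered sub-goal `stub_braidExit_radialLayer`** (the radial / far-field layer of
`stub_braidExit`, def-free form of `rowOperator_radialLayer_le`): for `L > 0`, `ν ≥ 0`, a profile `G`
with derivatives `G' ≥ 0`, `G''≤ 0` on an open `U ∋ log D`, at every point with `D > 0` the stub's
operator applied to `G(log D)` is `≤ −G'(log D) · b sinh b/(cosh b + 1)` (`b = 2πy/L`). [folklore] -/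
theorem stub_braidExit_radialLayer : ∀ (L ν : ℝ) (U : Set ℝ) (G G' G'' : ℝ → ℝ), 0 < L → 0 ≤ ν → IsOpen U → (∀ s ∈ U, HasDerivAt G (G' s) s) → (∀ s ∈ U, HasDerivAt G' (G'' s) s) → ∀ x y : ℝ, 0 < Real.cosh (2 * Real.pi * y / L) - Real.cos (2 * Real.pi * x / L) → Real.log (Real.cosh (2 * Real.pi * y / L) - Real.cos (2 * Real.pi * x / L)) ∈ U → 0 ≤ G' (Real.log (Real.cosh (2 * Real.pi * y / L) - Real.cos (2 * Real.pi * x / L))) → G'' (Real.log (Real.cosh (2 * Real.pi * y / L) - Real.cos (2 * Real.pi * x / L))) ≤ 0 → ν * lap (fun x y => G (Real.log (Real.cosh (2 * Real.pi * y / L) - Real.cos (2 * Real.pi * x / L)))) x y + Real.sinh (2 * Real.pi * y / L) / (2 * (Real.cosh (2 * Real.pi * y / L) - Real.cos (2 * Real.pi * x / L))) * dX (fun x y => G (Real.log (Real.cosh (2 * Real.pi * y / L) - Real.cos (2 * Real.pi * x / L)))) x y + (-(Real.sin (2 * Real.pi * x / L) / (2 * (Real.cosh (2 * Real.pi * y /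 L) - Real.cos (2 * Real.pi * x / L)))) - y) * dY (fun x y => G (Real.log (Real.cosh (2 * Real.pi * y / L) - Real.cos (2 * Real.pi * x / L)))) x y ≤ -(G' (Real.log (Real.cosh (2 * Real.pi * y / L) - Real.cos (2 * Real.pi * x / L))) * (2 * Real.pi * y / L * Real.sinh (2 * Real.pi * y / L) / (Real.cosh (2 * Real.pi * y / L) + 1))) := by
  intro L ν U G G' G'' hL hν hU hG hG' x y hD hU' hmono hconc
  exact rowOperator_radialLayer_le hU hG hG' hν hL hD hU' hmono hconc

end Summit.AnomalousDissipation.AnomalousDissipation.Theorems.MarginalStabilityChainStretchedVortexRows.BraidExit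

end
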